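import Summits.BirchSwinnertonDyer.BirchSwinnertonDyer.Theses.PrintCf2
import Summits.BirchSwinnertonDyer.BirchSwinnertonDyer.Theorems.PrintCf2RamifiedOffTYZLargeConductor
import Summits.BirchSwinnertonDyer.Rank1Residual.P2.CongruentNumberLevelTwoDoor
import Summits.BirchSwinnertonDyer.BirchSwinnertonDyer.Theorems.PrintCf2RamifiedOffTYZJumpOneIsogeny
import Summits.BirchSwinnertonDyer.BirchSwinnertonDyer.Theorems.PrintCf2RamifiedOffTYZSecondNormLaws
import HarnessLib

/-!
# SKELETON v10 of crux stmt-BirchSwinnertonDyer-20509 `RamifiedOffTYZOfFacts` (cell `bsd-print-cf2`, LEAD cruxlead-20509 g30, 2026-08-31)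

v10 (LEAD prover-cruxlead-stmt-BirchSwinnertonDyer-20509-g30-0, line `offtyz-v7`, lineage cycle 31) = v9 (planner g17, sha16 83c9d8b4cfc13e5f, header
kept below) **BY NAME — all eight v9 stubs byte-identical** (the six print doors, C⁺ = `stub_offTYZ_levelTwoScriptLExact` = item 23431, the residual
= item 23432; the v9 composition `RamifiedOffTYZOfFacts_of` and the bridge `ramifiedOffTYZOfFactsOfLevelTwo_holds` are unchanged) **PLUS THE RE-CUT OF
THE STUCK STUB C⁺ ALONG THE EXACT-DESCENT LINE** asked for by director-bsd (711)(C) («the CM-side law of the R2 sector as a STUB of the LEAD's own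
line») and the pen's SUMMON 2026-08-31T00:26:19Z («v10: the STUCK stub re-cut on R2»), in the currency that cycles 30–31 made exact
(g29 (A1)–(A3): `κ_{ℍ′}(Z(n)) = ([N_{H/L} x(z_n)], [N_{H(i)/M}(x(z_n) − 2i)])` in `ℍ′_n` itself, first coordinate = THEOREM A, second coordinate
non-congruence; g30 B1–B4: `ζ₈ ∉ ℍ′_n` and `Z(lq)` non-torsion discharged, so on the visible R2 rows C⁺ ⟺ THEOREM A ∧ «second norm ∉ ⟨i⟩ℍ′²»):
FOUR NEW STUBS, from which `𝔅_ram → C⁺` is DERIVED sorry-free (`offTYZ_levelTwoScriptLExact_of_recut`, real proof =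
`PrintCf2.SecondNormLaws.levelTwoScriptLExact_of_laws`, p803014) and the crux composed a second time (`RamifiedOffTYZOfFacts_of_recut`):

* `stub_offTYZ_tyzSevenBlockDisplay : tyz_sevenBlockCMData` — PRINT DOOR (width 0): Tian–Yuan–Zhang §3.1–3.2 AS PRINTED, the display fact of
  `Literature/…/TianYuanZhang2017/CMPointSevenBlockDisplays.lean` (genus points `Z(d₀) = Σ_{t∈Φ₀} z^t` as sums of conjugates of a CM point, no conjugate a
  cusp, `ℍ′_n = L_n(i)·∏H′_{d₀}`, Thm 3.5 at the blocks, Prop. 3.4, Lemma 3.18, Lemma 3.21); no `_holds` is expected (CM theory of `X₀(32)`, Gross–Zagier);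
  it is to C⁺'s re-cut what `tyz_genusPointData` is to the U⁺ door (aside 20471).  Every C⁺-reading of the lineage since g1 consumes it or a weaker display.
* `stub_offTYZ_firstNormSquare_R2` — **THEOREM A on R2** (PRINT-GRADE ON PAPER, g29 memo `Lines/offtyz_v7_ExactDescent.md` §2: `√x = η₁₆³/(η₈η₃₂²)` has
  character `(2/·)` on `Γ₀(32)`; Shimura reciprocity at the level-32 Heegner point gives `H(√x(z_n)) = R_{𝔭̄³}`; transfer in `Cl_{𝔭̄³}(K)`; for
  `(l/q) = 1` every divisor of `lq` is `≡ ±1 (mod 8)` so `[N_{H/L} x(z_{lq})]_L = 1`; 37/37 numerically incl. non-block-free predictions): for primes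
  `l ≡ 1`, `q ≡ 7 (mod 8)`, `(l/q) = 1`, `n = lq`, every display package `D` of `n` (`Printed`, CM-compositum layer, Thm 3.5 at blocks) and every
  realisation `(M, ι, (x₀,y₀), Φ)` of the seven-block display at `n` ((S1) `ι Z(n) = Σ_{t∈Φ} z^t`, `#Φ = g(n)`; (S2) no `z^t` a cusp; (S3) automorphisms
  trivial on `L_n(i)` permute the `z^t`), every `N₁ ∈ ℍ′_n` with `ι N₁ = ∏_{t∈Φ} t x₀` is a square.  Inputs to formalise: the η-quotient transformation
  law (Ligozat) and Shimura's reciprocity law at CM points with `32 ∣ a` (Gee–Stevenhagen / Cox §15) — Literature facts — plus ray-class-group algebra.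
* `stub_offTYZ_secondNormNonsquare_visR2` — **THE SECOND-NORM LAW on the visible R2 class rows** (CONJECTURE-GRADE; = the content of C⁺ there: by
  `GenusPeriodSecondNorm.levelTwo_iff_secondNorm_of_visible_R2` (p802722) and `SecondNormLaws.secondNormLaw_of_levelTwoScriptLExact` (p803014) it is
  EQUIVALENT to C⁺ on those rows granted THEOREM A — neither stronger nor weaker; `√(x − 2i)` is a NON-congruence modular function (g29 (A3)), so no
  reciprocity law evaluates it; descent side: the Cassels–Tate structure of `Sel₂(E_{lq})`): granted 𝔅_ram, on `n = lq` as above with `ord_{s=1} L(E_n,s) = 1`,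
  `#Sel₂(E_n) = 2⁵`, `#Sel₄(E_n) = 2⁶` and a VISIBLE generator (`X(h) ∉ 2ℚ^{×2}`), for every package / realisation / `N₁, N₀` with `ι N₀ = ∏(t x₀ − 2ι(i))`
  and `[N₁] = 1`: `N₀ ∉ ℍ′_n^{×2}` and `N₀·i ∉ ℍ′_n^{×2}`.  (Robust against the residual ambiguity of the displays: Lemma 3.21 pins `Z(n)` modulo `A[2]`,
  whose complete 2-descent classes are `1` and `(1,[i],[i])` — they preserve `[N₁]` and the coset `[N₀]·{1,[i]}`.)  g28's LAW Z⁺ names the class: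
  `[N₀] ≡ [π_l]^{[¬S]}[β_l]^{[¬x32]}` mod `[i]` (165/165 + kit 35/35).
* `stub_offTYZ_levelTwo_offVisR2` — **C⁺ OFF THE VISIBLE R2 ROWS** (CONJECTURE-GRADE remainder, granted 𝔅_ram): the text of C⁺ on the class rows that are
  NOT (`n = lq`, `l ≡ 1`, `q ≡ 7 (mod 8)`, `(l/q) = 1`, with a visible generator): the invisible R2 rows (`X(h) ∈ 2ℚ^{×2}`: there C⁺ ⟺ `Z ∈ 2A + tors ∧
  Z ∉ 4A + tors` / `Z − α_q ∉ 4A + tors` by g26's `GenusPeriodR2.levelTwo_iff_genusPeriod_R2[_delta]`), the R1 rows `n = lm`, `m ≡ 5 (mod 8)`, `n ≡ 6 (mod 8)`,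
  and three or more primes.

Registry after v10: stubs 12 = 8 (v9, byte-identical) + 4 (re-cut); closing EITHER {six doors, C⁺, residual} OR {six doors, residual, display door,
Theorem A, second-norm law, off-visible-R2 remainder} closes the crux by name (two sorry-free compositions below).  Stubs open 12 / closed 0 / delegated 0;
print-grade among the open: the six doors, the display door, THEOREM A; conjecture-grade: C⁺ (23431) ⟺ {second-norm law, remainder} ∪ …, residual (23432).
Kernel record under the re-cut (all `--supports 20509`): p799839, p800643, p800713, p800776, p801252 (g29); p802109, p802477, p802722, p803014 (g30).
BSD is not proved by any of this; no class is closed by this file; 20509 / 23431 / 23432 OPEN.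

## v9 header (planner g17), kept for the record

# SKELETON v9 of crux stmt-BirchSwinnertonDyer-20509 `RamifiedOffTYZOfFacts` (cell `bsd-print-cf2`, planner g17, 2026-08-28)

v9 (planner-bsd-print-cf2-plan-g17-0) = v8 (LEAD cruxlead-20509 g0, sha16 3f8d68c02f13c858, tree
`Cruxes/RamifiedOffTYZOfFacts/Lines/offtyz_v7.lean`; header kept below) **BY NAME**: after route rev 33 (planner g17,
2026-08-28T21:16Z) the two research stubs of v8 are ROUTE ITEMS of `route-BirchSwinnertonDyer-PrintCf2` —
`Summit.BirchSwinnertonDyer.BirchSwinnertonDyer.Theses.PrintCf2.RamifiedJumpOneLevelTwoOfFacts` (stmt-BirchSwinnertonDyer-23431, crux rank 5; = v8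
`stub_offTYZ_levelTwoScriptLExact` VERBATIM) and `Summit.BirchSwinnertonDyer.BirchSwinnertonDyer.Theses.PrintCf2.RamifiedOffJumpOneOfFacts` (stmt-BirchSwinnertonDyer-23432, crux rank 6;
= v8 `stub_offTYZ_residualOffJumpOneIsogeny` VERBATIM) — so the two stubs are RESTATED AS THOSE DECLS (same stub NAMES, signatures
now the item decls; definitionally equal to the v8 texts: see the two `_text` views below, proved by the stubs themselves), and the
composition runs through the route's by-name bridge `Summit.BirchSwinnertonDyer.BirchSwinnertonDyer.Theses.PrintCf2.RamifiedOffTYZOfFactsOfLevelTwo` (stmt-BirchSwinnertonDyer-23433), PROVED in this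
file (`ramifiedOffTYZOfFactsOfLevelTwo_holds`, real proof = v8's helper
`PrintCf2.ramifiedOffTYZOfFacts_of_leaves_of_levelTwo_of_offJumpOneIsogeny`, p650357). The six print-door stubs are VERBATIM v6/v7/v8
(names and signatures). NOTHING is weakened or strengthened: every proof aimed at a v8 stub lands unchanged (a proof of the v8 text of
C⁺ is a proof of `RamifiedJumpOneLevelTwoOfFacts` by `Iff.rfl`, and may now be proposed `--workitem stmt-BirchSwinnertonDyer-23431`
directly or `--supports stmt-BirchSwinnertonDyer-20509` as this stub). Purpose of the reshape: the registered skeleton now NAMES the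
route items it consists of (skeleton-aware cone of `closes`; planner.md BC6), so the C⁺ item is accounted and staffable at ITEM level
(director-bsd (232)(b)/(277): the C⁺ child id owed = stmt-BirchSwinnertonDyer-23431). Stubs open 8 / closed 0 / delegated 0.
Sharpened target for C⁺ (cruxlead g3, p665240/p666012/p666562): depth_{A(ℍ′_n)/tors} P(n) = depth Q₁, equivalently
v₂(𝓛(n)) = 1 + depth P(n) − depth Q₁ = 1 (first cases n = 205, 221). BSD is not proved by any of this; no class is closed by this file.

## v8 header (LEAD cruxlead-20509 g0), kept for the record

v8 (LEAD prover-cruxlead-stmt-BirchSwinnertonDyer-20509-g0-0, line `offtyz-v7`, cycle 1) = v7 (planner g12, sha16 54d7f62729747b28,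
below) with ONE reshape — the ISOGENY SATURATION of the jump-one class folded into the glue (card «routine add-on for the lead»;
helper `Theorems/PrintCf2RamifiedOffTYZJumpOneIsogeny.lean`, p650357): the residual stub `stub_offTYZ_residualOffJumpOne` (off the
ℚ-MODELS `C • E_n = W` of jump-one `E_n`) is REPLACED by `stub_offTYZ_residualOffJumpOneIsogeny` (off the ℚ-ISOGENY CLASSES
`IsIsogenous W (E_n)` of jump-one `E_n`; one negated hypothesis changed, everything else verbatim) — a WEAKER stub (v7's implies
it: `PrintCf2.offJumpOneIsogeny_of_offJumpOne`), so no proof aimed at v7 is invalidated; the member case of the glue is now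
`PrintCf2.bsdp_two_of_bundle_of_levelTwoScriptLExact_of_jumpOneIsogeny` (C⁺ + conjuncts 1, 2, 3, 5 of 𝔅_ram: door on `E_n`,
Faltings `analyticRank_eq_of_isIsogenous'`, Cassels transport `Wuthrich2014.bsdp_of_isIsogenous`). Removed from the residual by
name: for every jump-one `E_n` of analytic rank one its `j = 1728` partner `y² = x³ + 4n²x` and its two `j = 287496` partners.
The six print-door stubs and C⁺ = `stub_offTYZ_levelTwoScriptLExact` are VERBATIM v7. Composition `RamifiedOffTYZOfFacts_of` =
`PrintCf2.ramifiedOffTYZOfFacts_of_leaves_of_levelTwo_of_offJumpOneIsogeny` applied to the eight stubs (real proof, helper file).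
Stubs open 8 / closed 0 / delegated 0 (door stubs 1–6: width 0 by ruling; residual: width 0 until a lever is named; C⁺: LEAD).
BSD is not proved by any of this; no class is closed by this file.

## v7 header (planner g12), kept for the record

Line `offtyz-v7` = line `offtyz-v6` (skeleton of record, sha a61d8c37 / 76bdbfc9, seat p1 g4 + planner g5; card `Lines/offtyz-v6.md`)
with its ONE research stub `stub_offTYZ_residual` (𝔅_ram ⟹ the large-conductor residual off every booked class, NO PRINT) CUT ALONG
THE LEVEL-TWO DOOR landed by the cell typer (ty2 g11, `Summits/BirchSwinnertonDyer/Rank1Residual/P2/CongruentNumberLevelTwoDoor.lean`,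
p600241/p600425): the planner-g5 idea card `heegner-redei-level-two` (HOME `bsd-print-cf2-plan/Ideas/idea-heegner-redei-level-two.md`,
evidence on 20509) becomes a REGISTERED stub.

The six print-door stubs of v6 are kept VERBATIM (same names and signatures, so every v6 stub proof still lands `--supports 20509`):
`stub_offTYZ_uPlusLeaf` · `stub_offTYZ_thetaLeaf` · `stub_offTYZ_shuZhaiLeaf` · `stub_offTYZ_thetaFourLeaf` · `stub_offTYZ_thetaCriterionLeaf`
(each OPEN in-bundle with a CLOSED beyond-bundle twin aside: 20471 / 21185 / 21183+21395 / 21427 / 21428) · `stub_offTYZ_smallConductorLeaf`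
(OPEN in-bundle; all-type twin aside 20770 CLOSED; Plus-closer `PrintCf2.ramifiedSmallConductor_of_bundlePlus`, Creutz–Miller / Miller–Stoll BY NAME).
v6's `stub_offTYZ_residual` is now a THEOREM of this file (`offTYZ_residualV6_of_stubs`, via the glue
`offTYZ_residualV6_of_levelTwo_of_offJumpOne`, real proof) from TWO new stubs:

* `stub_offTYZ_levelTwoScriptLExact` — **C⁺, the research statement of the card, in the door's exact binder shape** (hypothesis `hC` of
  `P2.bsdp_two_congruentNumberCurve_of_levelTwoScriptLExact`, verbatim): for square-free `n ≡ 5, 6, 7 (mod 8)` with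
  `ord_{s=1} L(E_n, s) = 1`, `#Sel₂(E_n) = 2⁵` (Heath-Brown excess `s(n) = 3`) and `#Sel₄(E_n) = 2⁶` (the Cassels–Tate pairing on the
  excess is non-degenerate: Ш(E_n)[4] = Ш(E_n)[2], the «jump-one» / G-locus of the census), EVERY integer `L` with `𝓛(n)² = L²`
  (`TianYuanZhang2017.IsScriptL n L`) satisfies `2 ∣ L ∧ 4 ∤ L`. OPEN, NO PRINT (Tian–Yuan–Zhang's genus-period induction read one 2-adic
  digit up; nothing in print on the rank-one side at level 2). On that class the door is EXACT
  (`P2.bsdp_two_congruentNumberCurve_iff_two_dvd_not_four_dvd`: granted GZK, `BSD(E_n,2) ⟺ 2 ∥ L`), so C⁺ is EQUIVALENT to BSD₂ on the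
  jump-one class — not a strengthening. Census (instrument, not evidence of proof): G-locus = 2196 / 2417 = 90.9 % of category D
  (k ≤ 2 odd primes, n ≤ 10⁵; kit j299242), and Ш_an = 4.000… (38 digits, v₂ = 2) on 388 / 388 computed G members n ≤ 2·10⁴ (j300539) —
  i.e. C⁺ holds numerically on every computed case, 0 anomalies (HOME `bsd-print-cf2-plan/Ideas/census-1e5/ANALYSIS.md` + Addendum 2).
* `stub_offTYZ_residualOffJumpOne` — v6's residual with ONE MORE exclusion: `W` is not a `ℚ`-MODEL (`C • E_n = W`) of a jump-one `E_n`
  (`n` square-free, `n ≡ 5, 6, 7 (mod 8)`, `#Sel₂(E_n) = 2⁵`, `#Sel₄(E_n) = 2⁶`). OPEN, NO PRINT. Contains: the `E_m` classes of conductor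
  `≥ 5000` with `s(m) = 3` and Ш(E_m)[4] ≠ Ш(E_m)[2] (the census B-locus with `r_an = 1`: Ш_an = 16 on 14 / 14 computed, i.e. level ≥ 3),
  with `s(m) ≥ 5`, or `s(m) = 1` with even genus sums Θ-silent / θ-uncontrolled; the `j = 1728` ISOGENY PARTNERS of jump-one `E_n` that are
  not themselves models of one (isogeny saturation of the jump-one class by Cassels' invariance `Wuthrich2014.bsdp_of_isIsogenous` — conjunct 3
  of 𝔅_ram — is a routine add-on the lead may fold into the glue); quartic-twist classes without any `E_m`; all of `j = 8000`; each off the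
  Shu–Zhai / four-prime-theta / Θ-criterion classes and in conductor `≥ 5000` as in v6.

Glue (real proofs, no sorry): `offTYZ_residualV6_of_levelTwo_of_offJumpOne` (case split on jump-one model membership; the member case is
the door `P2.bsdp_two_of_levelTwoScriptLExact_of_smul_of_analyticRank_eq_one` fed with conjunct 5 `thm12_parity_of_scriptL'` and conjunct 1
GZK of 𝔅_ram) and the composition `RamifiedOffTYZOfFacts_of` through v6's helper
`PrintCf2.offTYZProved_of_bundle_of_uPlus_of_theta_of_shuZhai_of_thetaFour_of_thetaCriterion_of_smallConductor_of_offLarge` (p569950).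
Hardest stub: `stub_offTYZ_residualOffJumpOne` (XL, no lever in hand); first research target: `stub_offTYZ_levelTwoScriptLExact` (L).
Disproof used: none filed on 20509 (`ledger crux ls` empty). Dead lines honoured: the naive level-2 GENUS LAW for the CT step (card K1 as first
written) is FALSE beyond n = 8000 (census-30000 twin test: 2 mixed classes) — C⁺ does NOT use it: its hypothesis is the 4-Selmer count itself,
not a class-group predictor of it. BSD is not proved by any of this; no class is closed by this file.
-/

noncomputable section

open scoped Classical

open Summit.BirchSwinnertonDyer Summit.BirchSwinnertonDyer.BirchSwinnertonDyer.Theses.PrintCf2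
open Literature.NumberTheory.EllipticCurves Literature.NumberTheory.EllipticCurves.TianYuanZhang2017

namespace Summit.BirchSwinnertonDyer.PrintCf2

/-- STUB (open in-bundle; twin aside 20471 closed): 𝔅_ram ⟹ the U⁺-road leaf. -/
theorem stub_offTYZ_uPlusLeaf : (Literature.NumberTheory.EllipticCurves.rank_eq_analyticRank_of_analyticRank_le_one ∧ WeierstrassCurve.hasEntireLFunction_rat ∧ WeierstrassCurve.bsdRHS_eq_of_isIsogenous ∧ Literature.NumberTheory.EllipticCurves.bsdTriple_of_hasCM_of_L_one_ne_zero ∧ Literature.NumberTheory.EllipticCurves.TianYuanZhang2017.thm12_parity_of_scriptL' ∧ Literature.NumberTheory.EllipticCurves.Tian2014.thm13_rank_one_and_sha_odd ∧ Literature.NumberTheory.QuadraticFields.RedeiReichardt.redeiReichardt_fourTwoCard_classGroup ∧ Literature.NumberTheory.EllipticCurves.LiLiuTian2024.thm12_bsd_congruentNumberCurve ∧ Literature.NumberTheory.EllipticCurves.Monsky1990.cor515_rank_eq_one_and_card_selmerGroup_two ∧ Literature.NumberTheory.EllipticCurves.HeathBrown1994.monsky_card_selmerGroup_two_even ∧ Literature.NumberTheory.EllipticCurves.Tian2014.tian2014_system_sMinus_genus)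 → Summit.BirchSwinnertonDyer.WAllCornerFTwoRamifiedTYZUPlus := by
  sorry

/-- STUB (open in-bundle; twin aside 21185 closed): 𝔅_ram ⟹ the theta leaf. -/
theorem stub_offTYZ_thetaLeaf : (Literature.NumberTheory.EllipticCurves.rank_eq_analyticRank_of_analyticRank_le_one ∧ WeierstrassCurve.hasEntireLFunction_rat ∧ WeierstrassCurve.bsdRHS_eq_of_isIsogenous ∧ Literature.NumberTheory.EllipticCurves.bsdTriple_of_hasCM_of_L_one_ne_zero ∧ Literature.NumberTheory.EllipticCurves.TianYuanZhang2017.thm12_parity_of_scriptL' ∧ Literature.NumberTheory.EllipticCurves.Tian2014.thm13_rank_one_and_sha_odd ∧ Literature.NumberTheory.QuadraticFields.RedeiReichardt.redeiReichardt_fourTwoCard_classGroup ∧ Literature.NumberTheory.EllipticCurves.LiLiuTian2024.thm12_bsd_congruentNumberCurve ∧ Literature.NumberTheory.EllipticCurves.Monsky1990.cor515_rank_eq_one_and_card_selmerGroup_two ∧ Literature.NumberTheory.EllipticCurves.HeathBrown1994.monsky_card_selmerGroup_two_even ∧ Literature.NumberTheory.EllipticCurves.Tian2014.tian2014_system_sMinus_genus)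 → Summit.BirchSwinnertonDyer.WAllCornerFTwoRamifiedTheta := by
  sorry

/-- STUB (open in-bundle; twin asides 21183/21395 closed, seat p2): 𝔅_ram ⟹ the Shu–Zhai `256c1` leaf. -/
theorem stub_offTYZ_shuZhaiLeaf : (Literature.NumberTheory.EllipticCurves.rank_eq_analyticRank_of_analyticRank_le_one ∧ WeierstrassCurve.hasEntireLFunction_rat ∧ WeierstrassCurve.bsdRHS_eq_of_isIsogenous ∧ Literature.NumberTheory.EllipticCurves.bsdTriple_of_hasCM_of_L_one_ne_zero ∧ Literature.NumberTheory.EllipticCurves.TianYuanZhang2017.thm12_parity_of_scriptL' ∧ Literature.NumberTheory.EllipticCurves.Tian2014.thm13_rank_one_and_sha_odd ∧ Literature.NumberTheory.QuadraticFields.RedeiReichardt.redeiReichardt_fourTwoCard_classGroup ∧ Literature.NumberTheory.EllipticCurves.LiLiuTian2024.thm12_bsd_congruentNumberCurve ∧ Literature.NumberTheory.EllipticCurves.Monsky1990.cor515_rank_eq_one_and_card_selmerGroup_two ∧ Literature.NumberTheory.EllipticCurves.HeathBrown1994.monsky_card_selmerGroup_two_even ∧ Literature.NumberTheory.EllipticCurves.Tian2014.tian2014_system_sMinus_genus)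 → Summit.BirchSwinnertonDyer.WAllCornerFTwoRamifiedShuZhaiTwoFiftySix := by
  sorry

/-- STUB (open in-bundle; twin aside 21427 closed): 𝔅_ram ⟹ the four-prime theta leaf. -/
theorem stub_offTYZ_thetaFourLeaf : (Literature.NumberTheory.EllipticCurves.rank_eq_analyticRank_of_analyticRank_le_one ∧ WeierstrassCurve.hasEntireLFunction_rat ∧ WeierstrassCurve.bsdRHS_eq_of_isIsogenous ∧ Literature.NumberTheory.EllipticCurves.bsdTriple_of_hasCM_of_L_one_ne_zero ∧ Literature.NumberTheory.EllipticCurves.TianYuanZhang2017.thm12_parity_of_scriptL' ∧ Literature.NumberTheory.EllipticCurves.Tian2014.thm13_rank_one_and_sha_odd ∧ Literature.NumberTheory.QuadraticFields.RedeiReichardt.redeiReichardt_fourTwoCard_classGroup ∧ Literature.NumberTheory.EllipticCurves.LiLiuTian2024.thm12_bsd_congruentNumberCurve ∧ Literature.NumberTheory.EllipticCurves.Monsky1990.cor515_rank_eq_one_and_card_selmerGroup_two ∧ Literature.NumberTheory.EllipticCurves.HeathBrown1994.monsky_card_selmerGroup_two_even ∧ Literature.NumberTheory.EllipticCurves.Tian2014.tian2014_system_sMinus_genus)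 → Summit.BirchSwinnertonDyer.WAllCornerFTwoRamifiedThetaFour := by
  sorry

/-- STUB (open in-bundle; twin aside 21428 closed): 𝔅_ram ⟹ the uniform Θ-criterion leaf. -/
theorem stub_offTYZ_thetaCriterionLeaf : (Literature.NumberTheory.EllipticCurves.rank_eq_analyticRank_of_analyticRank_le_one ∧ WeierstrassCurve.hasEntireLFunction_rat ∧ WeierstrassCurve.bsdRHS_eq_of_isIsogenous ∧ Literature.NumberTheory.EllipticCurves.bsdTriple_of_hasCM_of_L_one_ne_zero ∧ Literature.NumberTheory.EllipticCurves.TianYuanZhang2017.thm12_parity_of_scriptL' ∧ Literature.NumberTheory.EllipticCurves.Tian2014.thm13_rank_one_and_sha_odd ∧ Literature.NumberTheory.QuadraticFields.RedeiReichardt.redeiReichardt_fourTwoCard_classGroup ∧ Literature.NumberTheory.EllipticCurves.LiLiuTian2024.thm12_bsd_congruentNumberCurve ∧ Literature.NumberTheory.EllipticCurves.Monsky1990.cor515_rank_eq_one_and_card_selmerGroup_two ∧ Literature.NumberTheory.EllipticCurves.HeathBrown1994.monsky_card_selmerGroup_two_even ∧ Literature.NumberTheory.EllipticCurves.Tian2014.tian2014_system_sMinus_genus)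 → Summit.BirchSwinnertonDyer.WAllCornerFTwoRamifiedThetaCriterion := by
  sorry

/-- STUB (open in-bundle; closable beyond it by `PrintCf2.ramifiedSmallConductor_of_bundlePlus`; all-type twin aside 20770
closed): 𝔅_ram ⟹ the ramified small-conductor leaf (conductor `< 5000`, Creutz–Miller / Miller–Stoll territory). -/
theorem stub_offTYZ_smallConductorLeaf : (Literature.NumberTheory.EllipticCurves.rank_eq_analyticRank_of_analyticRank_le_one ∧ WeierstrassCurve.hasEntireLFunction_rat ∧ WeierstrassCurve.bsdRHS_eq_of_isIsogenous ∧ Literature.NumberTheory.EllipticCurves.bsdTriple_of_hasCM_of_L_one_ne_zero ∧ Literature.NumberTheory.EllipticCurves.TianYuanZhang2017.thm12_parity_of_scriptL' ∧ Literature.NumberTheory.EllipticCurves.Tian2014.thm13_rank_one_and_sha_odd ∧ Literature.NumberTheory.QuadraticFields.RedeiReichardt.redeiReichardt_fourTwoCard_classGroup ∧ Literature.NumberTheory.EllipticCurves.LiLiuTian2024.thm12_bsd_congruentNumberCurve ∧ Literature.NumberTheory.EllipticCurves.Monsky1990.cor515_rank_eq_one_and_card_selmerGroup_two ∧ Literature.NumberTheory.EllipticCurves.HeathBrown1994.monsky_card_selmerGroup_two_even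 ∧ Literature.NumberTheory.EllipticCurves.Tian2014.tian2014_system_sMinus_genus) →
    (∀ (W : WeierstrassCurve ℚ) [W.IsElliptic] [W.IsGloballyMinimal],
      W.HasCM → W.analyticRank = 1 → Literature.NumberTheory.EllipticCurves.Rank1Residual.CMRamified W 2 →
        W.conductorNorm ℤ < 5000 → Literature.NumberTheory.EllipticCurves.BSDp W 2) := by
  sorry

/-- STUB **C⁺ = `LevelTwoScriptLExact`**, BY NAME = route item stmt-BirchSwinnertonDyer-23431 `PrintCf2.RamifiedJumpOneLevelTwoOfFacts`
(crux rank 5; OPEN, NO PRINT). Its text (VERBATIM v8, `Iff.rfl`): for square-free `n ≡ 5, 6, 7 (mod 8)` with `ord_{s=1} L(E_n,s) = 1`,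
`#Sel₂(E_n) = 2⁵`, `#Sel₄(E_n) = 2⁶`, EVERY integer `L` with `TianYuanZhang2017.IsScriptL n L` satisfies `2 ∣ L ∧ ¬ 4 ∣ L`.
Equivalent to `BSD(E_n, 2)` on that class granted GZK (`P2.bsdp_two_congruentNumberCurve_iff_two_dvd_not_four_dvd`).
Sharpened form (cruxlead g3): `depth P(n) = depth Q₁` in `A(ℍ′_n)/tors`. Size L–XL. -/
theorem stub_offTYZ_levelTwoScriptLExact : Summit.BirchSwinnertonDyer.BirchSwinnertonDyer.Theses.PrintCf2.RamifiedJumpOneLevelTwoOfFacts := by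
  sorry

/-- STUB (OPEN, NO PRINT), BY NAME = route item stmt-BirchSwinnertonDyer-23432 `PrintCf2.RamifiedOffJumpOneOfFacts` (crux rank 6; the
NAMED RESIDUAL of the ramified type, width 0 until a lever is named). Its text is VERBATIM v8's `stub_offTYZ_residualOffJumpOneIsogeny`
(𝔅_ram ⟹ BSD(E,2) for CM rank-one E with 2 ramified in K, conductor ≥ 5000, off the four booked isogeny classes and off the
ℚ-isogeny classes of the jump-one `E_n`). Size XL. -/
theorem stub_offTYZ_residualOffJumpOneIsogeny : Summit.BirchSwinnertonDyer.BirchSwinnertonDyer.Theses.PrintCf2.RamifiedOffJumpOneOfFacts := by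
  sorry

/-- The v8 TEXT of C⁺, recovered from the by-name stub (definitional unfolding; documents v8 ⟺ v9). -/
theorem offTYZ_levelTwoScriptLExact_text :
    ∀ (n : ℕ) [(congruentNumberCurve n).IsElliptic] [(congruentNumberCurve n).IsGloballyMinimal],
      Squarefree n → (n % 8 = 5 ∨ n % 8 = 6 ∨ n % 8 = 7) →
      (congruentNumberCurve n).analyticRank = 1 →
      Nat.card ((congruentNumberCurve n).selmerGroup 2) = 2 ^ 5 →
      Nat.card ((congruentNumberCurve n).selmerGroup 4) = 2 ^ 6 →
      ∀ L : ℤ, IsScriptL n L → (2 : ℤ) ∣ L ∧ ¬ (4 : ℤ) ∣ L :=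
  stub_offTYZ_levelTwoScriptLExact

/-- The v8 TEXT of the isogeny-saturated residual, recovered from the by-name stub (definitional unfolding). -/
theorem offTYZ_residualOffJumpOneIsogeny_text : (Literature.NumberTheory.EllipticCurves.rank_eq_analyticRank_of_analyticRank_le_one ∧ WeierstrassCurve.hasEntireLFunction_rat ∧ WeierstrassCurve.bsdRHS_eq_of_isIsogenous ∧ Literature.NumberTheory.EllipticCurves.bsdTriple_of_hasCM_of_L_one_ne_zero ∧ Literature.NumberTheory.EllipticCurves.TianYuanZhang2017.thm12_parity_of_scriptL' ∧ Literature.NumberTheory.EllipticCurves.Tian2014.thm13_rank_one_and_sha_odd ∧ Literature.NumberTheory.QuadraticFields.RedeiReichardt.redeiReichardt_fourTwoCard_classGroup ∧ Literature.NumberTheory.EllipticCurves.LiLiuTian2024.thm12_bsd_congruentNumberCurve ∧ Literature.NumberTheory.EllipticCurves.Monsky1990.cor515_rank_eq_one_and_card_selmerGroup_two ∧ Literature.NumberTheory.EllipticCurves.HeathBrown1994.monsky_card_selmerGroup_two_even ∧ Literature.NumberTheory.EllipticCurves.Tian2014.tian2014_system_sMinus_genus) →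
    (∀ (W : WeierstrassCurve ℚ) [W.IsElliptic] [W.IsGloballyMinimal],
      W.HasCM → W.analyticRank = 1 → Literature.NumberTheory.EllipticCurves.Rank1Residual.CMRamified W 2 →
        ¬ Summit.BirchSwinnertonDyer.CongruentBookedIsogenyClass W →
        ¬ Summit.BirchSwinnertonDyer.Rank1Residual.P2.IsIsogenousToShuZhaiTwoFiftySixTwist W →
        ¬ Summit.BirchSwinnertonDyer.CongruentThetaFourIsogenyClass W →
        ¬ Summit.BirchSwinnertonDyer.CongruentThetaCriterionIsogenyClass W →
        5000 ≤ W.conductorNorm ℤ →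
        ¬ (∃ n : ℕ, Squarefree n ∧ (n % 8 = 5 ∨ n % 8 = 6 ∨ n % 8 = 7) ∧
            Nat.card ((congruentNumberCurve n).selmerGroup 2) = 2 ^ 5 ∧
            Nat.card ((congruentNumberCurve n).selmerGroup 4) = 2 ^ 6 ∧ WeierstrassCurve.IsIsogenous W (congruentNumberCurve n)) →
        Literature.NumberTheory.EllipticCurves.BSDp W 2) :=
  stub_offTYZ_residualOffJumpOneIsogeny

/-- v6's residual stub `stub_offTYZ_residual`, DERIVED as in v8 (landed glue `PrintCf2.offTYZ_residualV6_of_levelTwo_of_offJumpOneIsogeny`). -/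
theorem offTYZ_residualV6_of_stubs : (Literature.NumberTheory.EllipticCurves.rank_eq_analyticRank_of_analyticRank_le_one ∧ WeierstrassCurve.hasEntireLFunction_rat ∧ WeierstrassCurve.bsdRHS_eq_of_isIsogenous ∧ Literature.NumberTheory.EllipticCurves.bsdTriple_of_hasCM_of_L_one_ne_zero ∧ Literature.NumberTheory.EllipticCurves.TianYuanZhang2017.thm12_parity_of_scriptL' ∧ Literature.NumberTheory.EllipticCurves.Tian2014.thm13_rank_one_and_sha_odd ∧ Literature.NumberTheory.QuadraticFields.RedeiReichardt.redeiReichardt_fourTwoCard_classGroup ∧ Literature.NumberTheory.EllipticCurves.LiLiuTian2024.thm12_bsd_congruentNumberCurve ∧ Literature.NumberTheory.EllipticCurves.Monsky1990.cor515_rank_eq_one_and_card_selmerGroup_two ∧ Literature.NumberTheory.EllipticCurves.HeathBrown1994.monsky_card_selmerGroup_two_even ∧ Literature.NumberTheory.EllipticCurves.Tian2014.tian2014_system_sMinus_genus) →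
    (∀ (W : WeierstrassCurve ℚ) [W.IsElliptic] [W.IsGloballyMinimal],
      W.HasCM → W.analyticRank = 1 → Literature.NumberTheory.EllipticCurves.Rank1Residual.CMRamified W 2 →
        ¬ Summit.BirchSwinnertonDyer.CongruentBookedIsogenyClass W →
        ¬ Summit.BirchSwinnertonDyer.Rank1Residual.P2.IsIsogenousToShuZhaiTwoFiftySixTwist W →
        ¬ Summit.BirchSwinnertonDyer.CongruentThetaFourIsogenyClass W →
        ¬ Summit.BirchSwinnertonDyer.CongruentThetaCriterionIsogenyClass W →
        5000 ≤ W.conductorNorm ℤ → Literature.NumberTheory.EllipticCurves.BSDp W 2) :=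
  offTYZ_residualV6_of_levelTwo_of_offJumpOneIsogeny stub_offTYZ_levelTwoScriptLExact stub_offTYZ_residualOffJumpOneIsogeny

/-- The route's by-name BRIDGE item stmt-BirchSwinnertonDyer-23433 `PrintCf2.RamifiedOffTYZOfFactsOfLevelTwo`
(C⁺ → residual → (𝔅_ram → the six in-bundle doors) → `RamifiedOffTYZOfFacts`), PROVED — real proof through v8's helper
(p650357). This term is also the TURNKEY closer of that item (`Theorems/PrintCf2RamifiedOffTYZOfLevelTwo.lean`). -/
theorem ramifiedOffTYZOfFactsOfLevelTwo_holds : Summit.BirchSwinnertonDyer.BirchSwinnertonDyer.Theses.PrintCf2.RamifiedOffTYZOfFactsOfLevelTwo :=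
  fun hL hO hD =>
    ramifiedOffTYZOfFacts_of_leaves_of_levelTwo_of_offJumpOneIsogeny (fun hB => (hD hB).1) (fun hB => (hD hB).2.1)
      (fun hB => (hD hB).2.2.1) (fun hB => (hD hB).2.2.2.1) (fun hB => (hD hB).2.2.2.2.1) (fun hB => (hD hB).2.2.2.2.2) hL hO

/-- COMPOSITION: the crux decl BY NAME from the eight stubs, through the by-name bridge. -/
theorem RamifiedOffTYZOfFacts_of : RamifiedOffTYZOfFacts :=
  ramifiedOffTYZOfFactsOfLevelTwo_holds stub_offTYZ_levelTwoScriptLExact stub_offTYZ_residualOffJumpOneIsogeny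
    (fun hB => ⟨stub_offTYZ_uPlusLeaf hB, stub_offTYZ_thetaLeaf hB, stub_offTYZ_shuZhaiLeaf hB, stub_offTYZ_thetaFourLeaf hB,
      stub_offTYZ_thetaCriterionLeaf hB, stub_offTYZ_smallConductorLeaf hB⟩)

/-- v8's composition, kept (same eight stubs, direct through the helper): documents that v9 changes no content. -/
theorem RamifiedOffTYZOfFacts_of' : RamifiedOffTYZOfFacts :=
  ramifiedOffTYZOfFacts_of_leaves_of_levelTwo_of_offJumpOneIsogeny stub_offTYZ_uPlusLeaf stub_offTYZ_thetaLeaf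
    stub_offTYZ_shuZhaiLeaf stub_offTYZ_thetaFourLeaf stub_offTYZ_thetaCriterionLeaf stub_offTYZ_smallConductorLeaf
    stub_offTYZ_levelTwoScriptLExact stub_offTYZ_residualOffJumpOneIsogeny

/-! ## v10: THE RE-CUT OF C⁺ ALONG THE EXACT-DESCENT LINE (four new stubs; `𝔅_ram → C⁺` derived; second composition) -/

/-- STUB (PRINT DOOR, width 0; v10): **Tian–Yuan–Zhang §3.1–3.2 AS PRINTED** — the display fact `tyz_sevenBlockCMData` (genus points as sums of
conjugates of CM points, the compositum `ℍ′_n`, Thm 3.5 at blocks, Prop. 3.4, Lemma 3.18, Lemma 3.21). No `_holds` expected. -/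
theorem stub_offTYZ_tyzSevenBlockDisplay : Literature.NumberTheory.EllipticCurves.TianYuanZhang2017.tyz_sevenBlockCMData := by
  sorry

/-- STUB (PRINT-GRADE ON PAPER; v10): **THEOREM A on R2** — for primes `l ≡ 1`, `q ≡ 7 (mod 8)` with `(l/q) = 1` and `n = lq`, in every display package of `n`
and every realisation of the seven-block display at `n`, the first norm `N₁ = N_{H/L} x(z_n)` (`ι N₁ = ∏_{t∈Φ} t x₀`) is a square in `ℍ′_n`
(g29 memo `Lines/offtyz_v7_ExactDescent.md` §2: η-quotient character of `√x`, Shimura reciprocity, transfer; 37/37). Size M–L (two Literature facts + ray-class algebra). -/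
theorem stub_offTYZ_firstNormSquare_R2 :
    ∀ (l q n : ℕ), l.Prime → q.Prime → l % 8 = 1 → q % 8 = 7 → IsSquare ((l : ℤ) : ZMod q) → n = l * q →
      ∀ (D : GenusPointData n), D.Printed → D.CMPointCompositumPrinted → D.Thm35AtBlocks →
      ∀ (M : Type) (_ : Field M) (_ : NumberField M) (_ : IsGalois ℚ M) (ι : D.H →ₐ[ℚ] M) (x₀ y₀ : M)
        (h₀ : (curveA.baseChange M).toAffine.Nonsingular x₀ y₀) (Φ : Finset (M ≃ₐ[ℚ] M)),
        (WeierstrassCurve.Affine.Point.map (W' := curveA) ι (D.Z n) = ∑ t ∈ Φ, GenusPointData.galPtOver M t (.some x₀ y₀ h₀) ∧ Φ.card = gK n) →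
        (∀ t ∈ Φ, ¬ ((2 : ℕ) • GenusPointData.galPtOver M t (.some x₀ y₀ h₀) = 0 ∨ (2 : ℕ) • GenusPointData.galPtOver M t (.some x₀ y₀ h₀) = tauOne)) →
        (∀ g : M ≃ₐ[ℚ] M, D.TrivialOnLOver ι n g →
          ∃ π : Φ → Φ, Function.Bijective π ∧
            ∀ t : Φ, GenusPointData.galPtOver M g (GenusPointData.galPtOver M (t : M ≃ₐ[ℚ] M) (.some x₀ y₀ h₀)) =
              GenusPointData.galPtOver M (π t : M ≃ₐ[ℚ] M) (.some x₀ y₀ h₀)) →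
        ∀ N₁ : D.H, ι N₁ = ∏ t ∈ Φ, (t : M ≃ₐ[ℚ] M) x₀ → ∃ r : D.H, N₁ = r ^ 2 := by
  sorry

/-- STUB (CONJECTURE-GRADE; v10): **THE SECOND-NORM LAW on the visible R2 class rows** — granted 𝔅_ram, on `n = lq` (`l ≡ 1`, `q ≡ 7 (mod 8)`, `(l/q) = 1`)
with `ord_{s=1} L(E_n, s) = 1`, `#Sel₂(E_n) = 2⁵`, `#Sel₄(E_n) = 2⁶` and a VISIBLE generator of `A_n(ℚ)` modulo torsion (`X ∉ 2ℚ^{×2}`), for every package,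
realisation and norms `N₁, N₀` (`ι N₀ = ∏(t x₀ − 2ι(i)) = N_{H(i)/M}(x(z_n) − 2i)`) with `[N₁] = 1`: `N₀ ∉ ℍ′_n^{×2}` and `N₀·i ∉ ℍ′_n^{×2}`.  EQUIVALENT to C⁺
on those rows granted THEOREM A (p802722 / p803014 §3); `√(x − 2i)` is non-congruence (g29 (A3)). Size L (= BSD₂ on the visible R2 class rows). -/
theorem stub_offTYZ_secondNormNonsquare_visR2 : (Literature.NumberTheory.EllipticCurves.rank_eq_analyticRank_of_analyticRank_le_one ∧ WeierstrassCurve.hasEntireLFunction_rat ∧ WeierstrassCurve.bsdRHS_eq_of_isIsogenous ∧ Literature.NumberTheory.EllipticCurves.bsdTriple_of_hasCM_of_L_one_ne_zero ∧ Literature.NumberTheory.EllipticCurves.TianYuanZhang2017.thm12_parity_of_scriptL' ∧ Literature.NumberTheory.EllipticCurves.Tian2014.thm13_rank_one_and_sha_odd ∧ Literature.NumberTheory.QuadraticFields.RedeiReichardt.redeiReichardt_fourTwoCard_classGroup ∧ Literature.NumberTheory.EllipticCurves.LiLiuTian2024.thm12_bsd_congruentNumberCurve ∧ Literature.NumberTheory.EllipticCurves.Monsky1990.cor515_rank_eq_one_and_card_selmerGroup_two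 ∧ Literature.NumberTheory.EllipticCurves.HeathBrown1994.monsky_card_selmerGroup_two_even ∧ Literature.NumberTheory.EllipticCurves.Tian2014.tian2014_system_sMinus_genus) →
    ∀ (l q n : ℕ), l.Prime → q.Prime → l % 8 = 1 → q % 8 = 7 → IsSquare ((l : ℤ) : ZMod q) → n = l * q →
      (congruentNumberCurve n).analyticRank = 1 →
      Nat.card ((congruentNumberCurve n).selmerGroup 2) = 2 ^ 5 → Nat.card ((congruentNumberCurve n).selmerGroup 4) = 2 ^ 6 →
      (∃ (X Y : ℚ) (h : (Literature.NumberTheory.EllipticCurves.TianYuanZhang2017.W2.Atwo n).toAffine.Nonsingular X Y),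
        (∀ P : (Literature.NumberTheory.EllipticCurves.TianYuanZhang2017.W2.Atwo n).toAffine.Point, ∃ m : ℤ, IsOfFinAddOrder (P - m • (WeierstrassCurve.Affine.Point.some X Y h : (Literature.NumberTheory.EllipticCurves.TianYuanZhang2017.W2.Atwo n).toAffine.Point))) ∧
          ¬ ∃ s : ℚ, X = 2 * s ^ 2) →
      ∀ (D : GenusPointData n), D.Printed → D.CMPointCompositumPrinted → D.Thm35AtBlocks →
      ∀ (M : Type) (_ : Field M) (_ : NumberField M) (_ : IsGalois ℚ M) (ι : D.H →ₐ[ℚ] M) (x₀ y₀ : M)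
        (h₀ : (curveA.baseChange M).toAffine.Nonsingular x₀ y₀) (Φ : Finset (M ≃ₐ[ℚ] M)),
        (WeierstrassCurve.Affine.Point.map (W' := curveA) ι (D.Z n) = ∑ t ∈ Φ, GenusPointData.galPtOver M t (.some x₀ y₀ h₀) ∧ Φ.card = gK n) →
        (∀ t ∈ Φ, ¬ ((2 : ℕ) • GenusPointData.galPtOver M t (.some x₀ y₀ h₀) = 0 ∨ (2 : ℕ) • GenusPointData.galPtOver M t (.some x₀ y₀ h₀) = tauOne)) →
        (∀ g : M ≃ₐ[ℚ] M, D.TrivialOnLOver ι n g →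
          ∃ π : Φ → Φ, Function.Bijective π ∧
            ∀ t : Φ, GenusPointData.galPtOver M g (GenusPointData.galPtOver M (t : M ≃ₐ[ℚ] M) (.some x₀ y₀ h₀)) =
              GenusPointData.galPtOver M (π t : M ≃ₐ[ℚ] M) (.some x₀ y₀ h₀)) →
        ∀ N₁ N₀ : D.H, ι N₁ = ∏ t ∈ Φ, (t : M ≃ₐ[ℚ] M) x₀ → ι N₀ = ∏ t ∈ Φ, ((t : M ≃ₐ[ℚ] M) x₀ - 2 * ι D.im) →
          WeierstrassCurve.Affine.sqClass N₁ = 1 → ¬ ((∃ s : D.H, N₀ = s ^ 2) ∨ ∃ s : D.H, N₀ * D.im = s ^ 2) := by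
  sorry

/-- STUB (CONJECTURE-GRADE remainder; v10): **C⁺ OFF THE VISIBLE R2 ROWS** — granted 𝔅_ram, the text of C⁺ on the jump-one rank-one class rows that are NOT
visible R2 rows (invisible R2 rows, R1 rows `n = lm` with `m ≡ 5 (mod 8)`, `n ≡ 6 (mod 8)`, three or more primes, `(l/q) = −1`). Size L–XL. -/
theorem stub_offTYZ_levelTwo_offVisR2 : (Literature.NumberTheory.EllipticCurves.rank_eq_analyticRank_of_analyticRank_le_one ∧ WeierstrassCurve.hasEntireLFunction_rat ∧ WeierstrassCurve.bsdRHS_eq_of_isIsogenous ∧ Literature.NumberTheory.EllipticCurves.bsdTriple_of_hasCM_of_L_one_ne_zero ∧ Literature.NumberTheory.EllipticCurves.TianYuanZhang2017.thm12_parity_of_scriptL' ∧ Literature.NumberTheory.EllipticCurves.Tian2014.thm13_rank_one_and_sha_odd ∧ Literature.NumberTheory.QuadraticFields.RedeiReichardt.redeiReichardt_fourTwoCard_classGroup ∧ Literature.NumberTheory.EllipticCurves.LiLiuTian2024.thm12_bsd_congruentNumberCurve ∧ Literature.NumberTheory.EllipticCurves.Monsky1990.cor515_rank_eq_one_and_card_selmerGroup_two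 ∧ Literature.NumberTheory.EllipticCurves.HeathBrown1994.monsky_card_selmerGroup_two_even ∧ Literature.NumberTheory.EllipticCurves.Tian2014.tian2014_system_sMinus_genus) →
    ∀ (n : ℕ) [(congruentNumberCurve n).IsElliptic] [(congruentNumberCurve n).IsGloballyMinimal],
      Squarefree n → (n % 8 = 5 ∨ n % 8 = 6 ∨ n % 8 = 7) →
      (congruentNumberCurve n).analyticRank = 1 →
      Nat.card ((congruentNumberCurve n).selmerGroup 2) = 2 ^ 5 →
      Nat.card ((congruentNumberCurve n).selmerGroup 4) = 2 ^ 6 →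
      ¬ ((∃ l q : ℕ, l.Prime ∧ q.Prime ∧ l % 8 = 1 ∧ q % 8 = 7 ∧ IsSquare ((l : ℤ) : ZMod q) ∧ n = l * q) ∧
          ∃ (X Y : ℚ) (h : (Literature.NumberTheory.EllipticCurves.TianYuanZhang2017.W2.Atwo n).toAffine.Nonsingular X Y),
            (∀ P : (Literature.NumberTheory.EllipticCurves.TianYuanZhang2017.W2.Atwo n).toAffine.Point, ∃ m : ℤ, IsOfFinAddOrder (P - m • (WeierstrassCurve.Affine.Point.some X Y h : (Literature.NumberTheory.EllipticCurves.TianYuanZhang2017.W2.Atwo n).toAffine.Point))) ∧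
              ¬ ∃ s : ℚ, X = 2 * s ^ 2) →
      ∀ L : ℤ, IsScriptL n L → (2 : ℤ) ∣ L ∧ ¬ (4 : ℤ) ∣ L := by
  sorry

/-- **`𝔅_ram → C⁺` DERIVED from the four v10 stubs** (sorry-free; real proof `PrintCf2.SecondNormLaws.levelTwoScriptLExact_of_laws`, p803014):
the conclusion is the TEXT of item 23431 `RamifiedJumpOneLevelTwoOfFacts` under the bundle. -/
theorem offTYZ_levelTwoScriptLExact_of_recut : (Literature.NumberTheory.EllipticCurves.rank_eq_analyticRank_of_analyticRank_le_one ∧ WeierstrassCurve.hasEntireLFunction_rat ∧ WeierstrassCurve.bsdRHS_eq_of_isIsogenous ∧ Literature.NumberTheory.EllipticCurves.bsdTriple_of_hasCM_of_L_one_ne_zero ∧ Literature.NumberTheory.EllipticCurves.TianYuanZhang2017.thm12_parity_of_scriptL' ∧ Literature.NumberTheory.EllipticCurves.Tian2014.thm13_rank_one_and_sha_odd ∧ Literature.NumberTheory.QuadraticFields.RedeiReichardt.redeiReichardt_fourTwoCard_classGroup ∧ Literature.NumberTheory.EllipticCurves.LiLiuTian2024.thm12_bsd_congruentNumberCurve ∧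 Literature.NumberTheory.EllipticCurves.Monsky1990.cor515_rank_eq_one_and_card_selmerGroup_two ∧ Literature.NumberTheory.EllipticCurves.HeathBrown1994.monsky_card_selmerGroup_two_even ∧ Literature.NumberTheory.EllipticCurves.Tian2014.tian2014_system_sMinus_genus) →
    Summit.BirchSwinnertonDyer.BirchSwinnertonDyer.Theses.PrintCf2.RamifiedJumpOneLevelTwoOfFacts :=
  fun hB => SecondNormLaws.levelTwoScriptLExact_of_laws hB stub_offTYZ_tyzSevenBlockDisplay stub_offTYZ_firstNormSquare_R2
    stub_offTYZ_secondNormNonsquare_visR2 stub_offTYZ_levelTwo_offVisR2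

/-- SECOND COMPOSITION (v10): the crux decl BY NAME from the six doors, the residual, and the four re-cut stubs (C⁺ derived under the bundle). -/
theorem RamifiedOffTYZOfFacts_of_recut : RamifiedOffTYZOfFacts := by
  intro hB
  exact ramifiedOffTYZOfFacts_of_leaves_of_levelTwo_of_offJumpOneIsogeny stub_offTYZ_uPlusLeaf stub_offTYZ_thetaLeaf
    stub_offTYZ_shuZhaiLeaf stub_offTYZ_thetaFourLeaf stub_offTYZ_thetaCriterionLeaf stub_offTYZ_smallConductorLeaf
    (offTYZ_levelTwoScriptLExact_of_recut hB) stub_offTYZ_residualOffJumpOneIsogeny hB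

end Summit.BirchSwinnertonDyer.PrintCf2

end
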